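import Literature.NumberTheory.Sieve.HeathBrownCubicGrossen
import Literature.Analysis.Fourier.TentFunction
import HarnessLib

/-!
# Heath-Brown's Lemma 9.5: the weight `W(S; Δ, 𝐱)` localises `𝐱` at a generator of `S`

Part of the reduction *Lemma 9.2 ⇐ Lemma 9.4* in §9 of D. R. Heath-Brown, *Primes represented by
`x³ + 2y³`*, Acta Math. 186 (2001) (this seat's route to the named fact `HeathBrown2001_lemma_3_8`, see
`HeathBrownCubicGrossen`). Lemma 9.5 (p. 56): "Let `V ≪ N(S)`, `N(𝐱) ≪ V`, and suppose that
`W(S; Δ, 𝐱) ≠ 0` and that `N(𝐱) < N(S) ≤ N(𝐱) + ΔV`. Then `S` has a generator `β` for which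
`β̂ = (1 + O(Δ))𝐱`. Similarly, if `β` is any generator of `S`, then `𝐱` has an associate `𝐱'` for which
`β̂ = (1 + O(Δ))𝐱'`", used on p. 57 as "`β̂ = 𝐱 + O(V^{1/3}Δ)`". Everything here is PROVED:

* the objects: `unitCoord b 𝐱 = σ = (log β(𝐱) − log β(b))/v` (the unit coordinate of `𝐱` relative to
  the generator vector `b`), the branch relation `Near b 𝐱 : σ ∈ [−1/2, 1/2)` (our replacement for the
  fundamental domain `𝓕` of p. 59 — "each non-zero `𝐱` has a unique associate in `𝓕`" becomes
  `existsUnique_near_generator`: for `S ≠ 0` exactly one generator `β > 0` has `Near β̂ 𝐱`), and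
  **`pairWeight Δ b 𝐱 = W(S; Δ, 𝐱) = h(arg(ν₁(b)/ν₁(𝐱))) h(arg(ν₂(b)/ν₂(𝐱)))`** (p. 53) with
  `h = angTent Δ` of `Literature.Analysis.Fourier.TentFunction` (independent of the generator:
  `pairWeight_realVec_mul_units`);
* the polar forms `ν₂(b)/ν₂(𝐱) = e(σ)`, `ν₁(b)/ν₁(𝐱) = exp(i(arg β'(b) − arg β'(𝐱) + uσ))`
  (`angTent_nu2_div`, `angTent_nu1_div`), whence on the branch `W ≠ 0` forces `|σ| < Δ`
  (`abs_unitCoord_lt`) and `arg β'(𝐱) = arg β'(b) + O(Δ)` (`exists_angle_of_pairWeight_ne_zero`, (9.13));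
* the printed chain (9.12) `β(𝐱) = (1+O(Δ))β(b)` (`abs_ell_sub_ell_le`), (9.14)
  `|β'(𝐱)| = (1+O(Δ))|β'(b)|` from `N = β|β'|²` and the window (`abs_norm_cplxEmb_sub_le`), hence
  `β'(𝐱) = (1+O(Δ))β'(b)` (`norm_cplxEmb_sub_le`), and the inversion of the Minkowski embedding `embW` of
  `HeathBrownCubicPolar` (`norm_embW_le`, `exists_norm_le_norm_embW`);
* **`HeathBrown2001_lemma_9_5`**: an absolute `C₀ > 0` with `‖𝐱 − b‖_∞ ≤ C₀(1 + c₄⁻¹)Δ‖b‖_∞` whenever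
  `0 < Δ ≤ min(1/16, c₄/2)`, `β(b), β(𝐱) > 0`, `Near b 𝐱`, `W ≠ 0`, `N(b) − ΔV ≤ N(𝐱) < N(b)` and
  `N(𝐱) ≥ c₄V > 0` (the constants `V ≪ N(S)`, `N(𝐱) ≪ V` of the lemma enter only through `c₄`), and the
  reading from `𝐱` (`norm_le_two_mul_of_norm_sub_le`).

## References

* D. R. Heath-Brown, *Primes represented by `x³ + 2y³`*, Acta Math. 186 (2001), §9: p. 53 (`W`), Lemma
  9.5 and its proof pp. 56–57 ((9.11)–(9.14)), p. 59 (`𝓕`). [cite: HeathBrownActa2001, Lemma 9.5]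
* G. Harman, *Prime-Detecting Sieves* (2007), §13.6 p. 276. [cite: Harman2007, §13.6]

## Mathlib / tree search

Tree: `HeathBrownCubicGrossen` (`nu1`, `nu2`, `unitLog`, `unitArg`, `unitVec`, `nu*_units`, `idealGen`),
`HeathBrownCubicRegulator` (`exists_units_eq_unitGen_zpow`, `ellO_units_zpow`), `HeathBrownCubicPolar` (`cplxEmb`,
`embW`, `embW_injective`, `ell_mul_normSq_cplxEmb`), `HeathBrownCubicWindow` (`rho_lt`, `unitE_lt_four`),
`TentFunction` (`angTent_exp`, `exists_abs_sub_int_lt_of_tentPer_ne_zero`). Mathlib: `Real.abs_exp_sub_one_le`,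
`Complex.norm_exp_sub_one_le`, `Complex.norm_mul_exp_arg_mul_I`, `LinearMap.linearEquivOfInjective`,
`LinearEquiv.toContinuousLinearEquiv`, `ContinuousLinearMap.le_opNorm`, `Int.floor_eq_iff`,
`Ideal.span_singleton_mul_right_unit`.
-/

noncomputable section

open Polynomial NumberField Finset Complex

namespace Literature.NumberTheory.Sieve.CubicSieve

open LFunctions.CubeRootTwoField CubicPrimes Literature.Analysis.Fourier

/-! ### The unit coordinate `σ(b, 𝐱)`, the branch relation and the weight `W` -/

/-- **The unit coordinate of `𝐱` relative to `b`**: `σ(b, 𝐱) = (log β(𝐱) − log β(b))/v`, `v = log E`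
(so `β(𝐱) = E^{σ} β(b)`; replacing `b` by `ε̂·b` shifts `σ` by `−1`). [cite: HeathBrownActa2001, §9 p. 57] -/
def unitCoord (b x : ℝ × ℝ × ℝ) : ℝ := (Real.log (ell x) - Real.log (ell b)) / unitLog

/-- **The branch relation** `Near b 𝐱`: `σ(b, 𝐱) ∈ [−1/2, 1/2)` — `𝐱` is closer (multiplicatively, in
the real embedding) to `b` than to any other associate `±ε̂ⁿ b`; our device replacing the
"fundamental domain `𝓕`" of p. 59. [cite: HeathBrownActa2001, §9 p. 59] -/
def Near (b x : ℝ × ℝ × ℝ) : Prop := unitCoord b x ∈ Set.Ico (-(1 / 2 : ℝ)) (1 / 2)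

/-- **Heath-Brown's weight `W(S; Δ, 𝐱) = h(arg(ν₁(S)/ν₁(𝐱))) h(arg(ν₂(S)/ν₂(𝐱)))`** (p. 53), written
for a coordinate vector `b` of a generator of `S` (it depends only on `S`: the `ν_i` are constant on
associates); `h` = `angTent Δ` (`Literature.Analysis.Fourier.TentFunction`). [cite: HeathBrownActa2001, §9 p. 53] -/
def pairWeight (Δ : ℝ) (b x : ℝ × ℝ × ℝ) : ℝ := angTent Δ (nu1 b / nu1 x) * angTent Δ (nu2 b / nu2 x)

variable {Δ : ℝ} {b x : ℝ × ℝ × ℝ}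

/-- `0 ≤ W ≤ 1`. [cite: HeathBrownActa2001, §9 p. 53] -/
theorem pairWeight_nonneg (Δ : ℝ) (b x : ℝ × ℝ × ℝ) : 0 ≤ pairWeight Δ b x :=
  mul_nonneg (angTent_nonneg _ _) (angTent_nonneg _ _)

/-- `W ≤ 1` (`Δ > 0`). [cite: HeathBrownActa2001, §9 p. 53] -/
theorem pairWeight_le_one (hΔ : 0 < Δ) (b x : ℝ × ℝ × ℝ) : pairWeight Δ b x ≤ 1 :=
  mul_le_one₀ (angTent_le_one hΔ _) (angTent_nonneg _ _) (angTent_le_one hΔ _)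

/-- `σ(b, b) = 0`. [folklore] -/
@[simp] theorem unitCoord_self (b : ℝ × ℝ × ℝ) : unitCoord b b = 0 := by simp [unitCoord]

/-- `σ(ε̂·b, 𝐱) = σ(b, 𝐱) − 1` (`β(ε̂b) = Eβ(b)`). [folklore] -/
theorem unitCoord_mulVec_unitVec (hb : 0 < ell b) (x : ℝ × ℝ × ℝ) :
    unitCoord (mulVec unitVec b) x = unitCoord b x - 1 := by
  rw [unitCoord, unitCoord, ell_mulVec, ell_unitVec, Real.log_mul unitE_pos.ne' hb.ne', unitLog]
  have hv : Real.log unitE ≠ 0 := (Real.log_pos one_lt_unitE).ne'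
  field_simp
  ring

/-! ### Polar forms of `ν₂(b)/ν₂(𝐱)` and `ν₁(b)/ν₁(𝐱)` -/

/-- **`ν₂(b)/ν₂(𝐱) = e(σ(b, 𝐱))`** for `β(b), β(𝐱) > 0`. [cite: HeathBrownActa2001, §9 p. 57] -/
theorem nu2_div_nu2 (hb : 0 < ell b) (hx : 0 < ell x) :
    nu2 b / nu2 x = Complex.exp (((2 * Real.pi * unitCoord b x : ℝ)) * Complex.I) := by
  rw [nu2, nu2, ← Complex.exp_sub, abs_of_pos hb, abs_of_pos hx, unitCoord]
  congr 1
  push_cast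
  ring

/-- The angular factor `ν₂`: `h(arg(ν₂(b)/ν₂(𝐱))) = tentPer Δ (σ(b, 𝐱))`. [cite: HeathBrownActa2001, §9 p. 57] -/
theorem angTent_nu2_div (hb : 0 < ell b) (hx : 0 < ell x) :
    angTent Δ (nu2 b / nu2 x) = tentPer Δ (unitCoord b x) := by
  rw [nu2_div_nu2 hb hx, angTent_exp, mul_div_assoc, mul_div_cancel₀ _ Real.two_pi_pos.ne']

/-- The direction factor of `ν₁`: `β'(p)/|β'(p)| = e^{i arg β'(p)}`. [folklore] -/
theorem cplxEmb_div_norm (hp : cplxEmb x ≠ 0) :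
    cplxEmb x / (‖cplxEmb x‖ : ℂ) = Complex.exp (Complex.arg (cplxEmb x) * Complex.I) := by
  have h := Complex.norm_mul_exp_arg_mul_I (cplxEmb x)
  have hn : (‖cplxEmb x‖ : ℂ) ≠ 0 := by rw [Ne, Complex.ofReal_eq_zero, norm_eq_zero]; exact hp
  rw [div_eq_iff hn, mul_comm, h]

/-- **`ν₁` in polar form** for `β(p) > 0`, `β'(p) ≠ 0`:
`ν₁(p) = exp(i(arg β'(p) − u σ₀(p)))`, `σ₀(p) = log β(p)/v`. [cite: HeathBrownActa2001, §9 (9.2)] -/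
theorem nu1_eq_exp (hx : 0 < ell x) (hp : cplxEmb x ≠ 0) :
    nu1 x = Complex.exp (((Complex.arg (cplxEmb x) - unitArg * (Real.log (ell x) / unitLog) : ℝ)) * Complex.I) := by
  have hxC : (ell x : ℂ) ≠ 0 := Complex.ofReal_ne_zero.mpr hx.ne'
  rw [nu1, abs_of_pos hx, norm_mul, Complex.norm_real, Real.norm_eq_abs, abs_of_pos hx, Complex.ofReal_mul,
    mul_div_mul_left _ _ hxC, cplxEmb_div_norm hp, ← Complex.exp_add]
  congr 1; push_cast; ring

/-- **`ν₁(b)/ν₁(𝐱) = exp(i(arg β'(b) − arg β'(𝐱) + u σ(b, 𝐱)))`.** [cite: HeathBrownActa2001, §9 p. 57] -/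
theorem nu1_div_nu1 (hb : 0 < ell b) (hb' : cplxEmb b ≠ 0) (hx : 0 < ell x) (hx' : cplxEmb x ≠ 0) :
    nu1 b / nu1 x = Complex.exp (((Complex.arg (cplxEmb b) - Complex.arg (cplxEmb x) +
      unitArg * unitCoord b x : ℝ)) * Complex.I) := by
  rw [nu1_eq_exp hb hb', nu1_eq_exp hx hx', ← Complex.exp_sub, unitCoord]
  congr 1; push_cast; ring

/-- The angular factor `ν₁`: `h(arg(ν₁(b)/ν₁(𝐱))) = tentPer Δ ((arg β'(b) − arg β'(𝐱) + uσ)/2π)`.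
[cite: HeathBrownActa2001, §9 p. 57] -/
theorem angTent_nu1_div (hb : 0 < ell b) (hb' : cplxEmb b ≠ 0) (hx : 0 < ell x) (hx' : cplxEmb x ≠ 0) :
    angTent Δ (nu1 b / nu1 x) =
      tentPer Δ ((Complex.arg (cplxEmb b) - Complex.arg (cplxEmb x) + unitArg * unitCoord b x) / (2 * Real.pi)) := by
  rw [nu1_div_nu1 hb hb' hx hx', angTent_exp]

/-! ### Consequences of `W ≠ 0` on the branch: the two angular windows -/

/-- If `W(b, 𝐱) ≠ 0` on the branch `Near b 𝐱` then **`|σ(b, 𝐱)| < Δ`** (`Δ ≤ 1/4`): the `ν₂`-factor is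
`tentPer Δ σ ≠ 0`, so `σ` is within `Δ` of an integer, which must be `0`. [cite: HeathBrownActa2001, §9 p. 57] -/
theorem abs_unitCoord_lt (hΔ : 0 < Δ) (hΔ4 : Δ ≤ 1 / 4) (hb : 0 < ell b) (hx : 0 < ell x)
    (hnear : Near b x) (hW : pairWeight Δ b x ≠ 0) : |unitCoord b x| < Δ := by
  have h2 : angTent Δ (nu2 b / nu2 x) ≠ 0 := fun h => hW (by rw [pairWeight, h, mul_zero])
  rw [angTent_nu2_div hb hx] at h2
  obtain ⟨n, hn⟩ := exists_abs_sub_int_lt_of_tentPer_ne_zero hΔ h2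
  obtain ⟨hl, hr⟩ := hnear
  have hn0 : n = 0 := by
    have h1 : |(n : ℝ)| < 1 := by
      have := abs_sub_abs_le_abs_sub (n : ℝ) (unitCoord b x)
      rw [abs_sub_comm] at hn
      have : |unitCoord b x| ≤ 1 / 2 := abs_le.mpr ⟨by linarith, by linarith⟩
      linarith
    have : |n| < 1 := by exact_mod_cast h1
    exact Int.abs_lt_one_iff.mp this
  rw [hn0, Int.cast_zero, sub_zero] at hn
  exact hn

/-- If `W(b, 𝐱) ≠ 0` on the branch then **the directions of `β'(b)` and `β'(𝐱)` differ by an angle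
`η` with `|η| ≤ 3πΔ`**: `e^{i arg β'(𝐱)} = e^{i arg β'(b)} e^{iη}` (the `ν₁`-factor forces
`arg β'(b) − arg β'(𝐱) + uσ` within `2πΔ` of `2πℤ`, and `|uσ| ≤ πΔ`). [cite: HeathBrownActa2001, §9 (9.13)] -/
theorem exists_angle_of_pairWeight_ne_zero (hΔ : 0 < Δ) (hΔ4 : Δ ≤ 1 / 4) (hb : 0 < ell b)
    (hb' : cplxEmb b ≠ 0) (hx : 0 < ell x) (hx' : cplxEmb x ≠ 0) (hnear : Near b x) (hW : pairWeight Δ b x ≠ 0) :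
    ∃ η : ℝ, |η| ≤ 3 * Real.pi * Δ ∧
      Complex.exp (Complex.arg (cplxEmb x) * Complex.I) =
        Complex.exp (Complex.arg (cplxEmb b) * Complex.I) * Complex.exp (η * Complex.I) := by
  have hσ := abs_unitCoord_lt hΔ hΔ4 hb hx hnear hW
  have h1 : angTent Δ (nu1 b / nu1 x) ≠ 0 := fun h => hW (by rw [pairWeight, h, zero_mul])
  rw [angTent_nu1_div hb hb' hx hx'] at h1
  obtain ⟨n, hn⟩ := exists_abs_sub_int_lt_of_tentPer_ne_zero hΔ h1
  set ψ : ℝ := Complex.arg (cplxEmb b) - Complex.arg (cplxEmb x) + unitArg * unitCoord b x - 2 * Real.pi * n with hψ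
  have hψb : |ψ| < 2 * Real.pi * Δ := by
    have : ψ = 2 * Real.pi * ((Complex.arg (cplxEmb b) - Complex.arg (cplxEmb x) + unitArg * unitCoord b x) /
        (2 * Real.pi) - n) := by rw [hψ]; field_simp
    rw [this, abs_mul, abs_of_pos Real.two_pi_pos]
    exact mul_lt_mul_of_pos_left hn Real.two_pi_pos
  refine ⟨unitArg * unitCoord b x - ψ, ?_, ?_⟩
  · have hu : |unitArg| ≤ Real.pi := Complex.abs_arg_le_pi _
    calc |unitArg * unitCoord b x - ψ| ≤ |unitArg * unitCoord b x| + |ψ| := abs_sub _ _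
      _ ≤ Real.pi * Δ + 2 * Real.pi * Δ :=
          add_le_add (by rw [abs_mul]; exact mul_le_mul hu hσ.le (abs_nonneg _) Real.pi_pos.le) hψb.le
      _ = 3 * Real.pi * Δ := by ring
  · rw [← Complex.exp_add]
    have : (Complex.arg (cplxEmb b) : ℂ) * Complex.I + ((unitArg * unitCoord b x - ψ : ℝ) : ℂ) * Complex.I =
        Complex.arg (cplxEmb x) * Complex.I + (n : ℂ) * (2 * Real.pi * Complex.I) := by
      rw [hψ]; push_cast; ring
    rw [this, Complex.exp_add, Complex.exp_int_mul_two_pi_mul_I, mul_one]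

/-! ### Sizes: `β(𝐱) ≈ β(b)`, `|β'(𝐱)| ≈ |β'(b)|`, `β'(𝐱) ≈ β'(b)` -/

/-- `v = log E ≤ 2` (`E < 4 < e²`). [folklore] -/
theorem unitLog_le_two : unitLog ≤ 2 := by
  rw [unitLog]
  have h4 : Real.log unitE ≤ Real.log 4 := Real.log_le_log unitE_pos unitE_lt_four.le
  have : Real.log 4 ≤ 2 := by
    rw [show (4 : ℝ) = 2 ^ 2 by norm_num, Real.log_pow]
    have := Real.log_two_lt_d9; norm_num at this ⊢; linarith
  linarith

/-- **(9.12): `β(𝐱) = (1 + O(Δ))β(b)`**, precisely `|β(𝐱) − β(b)| ≤ 2vΔ·β(b)` when `|σ| < Δ ≤ 1/4`.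
[cite: HeathBrownActa2001, §9 (9.12)] -/
theorem abs_ell_sub_ell_le (hΔ4 : Δ ≤ 1 / 4) (hb : 0 < ell b) (hx : 0 < ell x) (hσ : |unitCoord b x| < Δ) :
    |ell x - ell b| ≤ 2 * unitLog * Δ * ell b := by
  have hv := unitLog_pos
  have hv2 := unitLog_le_two
  have hexp : ell x = ell b * Real.exp (unitLog * unitCoord b x) := by
    have : unitLog * unitCoord b x = Real.log (ell x) - Real.log (ell b) := by
      rw [unitCoord]; field_simp
    rw [this, Real.exp_sub, Real.exp_log hx, Real.exp_log hb]; field_simp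
  have hsmall : |unitLog * unitCoord b x| ≤ 1 := by
    rw [abs_mul, abs_of_pos hv]; nlinarith [abs_nonneg (unitCoord b x)]
  have h1 := Real.abs_exp_sub_one_le hsmall
  rw [hexp, show ell b * Real.exp (unitLog * unitCoord b x) - ell b = ell b * (Real.exp (unitLog * unitCoord b x) - 1) by ring,
    abs_mul, abs_of_pos hb]
  rw [abs_mul, abs_of_pos hv] at h1
  calc ell b * |Real.exp (unitLog * unitCoord b x) - 1| ≤ ell b * (2 * (unitLog * |unitCoord b x|)) :=
        mul_le_mul_of_nonneg_left h1 hb.le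
    _ ≤ ell b * (2 * (unitLog * Δ)) := by gcongr
    _ = 2 * unitLog * Δ * ell b := by ring

/-- `N = β·|β'|²` in the form `|β'|² = N/β`. [folklore] -/
theorem norm_cplxEmb_sq (hx : 0 < ell x) : ‖cplxEmb x‖ ^ 2 = normForm x / ell x := by
  rw [← ell_mul_normSq_cplxEmb, Complex.normSq_eq_norm_sq]; field_simp

/-- For `r ≥ 0`: `|r − 1| ≤ |r² − 1|`. [folklore] -/
theorem abs_sub_one_le_abs_sq_sub_one {r : ℝ} (hr : 0 ≤ r) : |r - 1| ≤ |r ^ 2 - 1| := by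
  rw [show r ^ 2 - 1 = (r - 1) * (r + 1) by ring, abs_mul]
  have : 1 ≤ |r + 1| := by rw [abs_of_nonneg (by linarith)]; linarith
  nlinarith [abs_nonneg (r - 1)]

/-- **(9.14): `|β'(𝐱)| = (1 + O(Δ))|β'(b)|`**: with `|σ| < Δ ≤ 1/4`, `N(𝐱) ∈ [N(b) − ΔV, N(b))` and
`N(𝐱) ≥ c₄V > 0`, one has `| ‖β'(𝐱)‖ − ‖β'(b)‖ | ≤ (Δ/c₄ + 4vΔ)‖β'(b)‖`. [cite: HeathBrownActa2001, §9 (9.14)] -/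
theorem abs_norm_cplxEmb_sub_le {c₄ V : ℝ} (hc₄ : 0 < c₄) (hV : 0 < V) (hΔ : 0 < Δ) (hΔ4 : Δ ≤ 1 / 4)
    (hΔc : Δ ≤ c₄) (hb : 0 < ell b) (hx : 0 < ell x) (hσ : |unitCoord b x| < Δ)
    (hwin : normForm b - Δ * V ≤ normForm x ∧ normForm x < normForm b) (hNx : c₄ * V ≤ normForm x) :
    |‖cplxEmb x‖ - ‖cplxEmb b‖| ≤ (Δ / c₄ + 4 * unitLog * Δ) * ‖cplxEmb b‖ := by
  have hv := unitLog_pos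
  have hv2 := unitLog_le_two
  have hNx0 : 0 < normForm x := lt_of_lt_of_le (by positivity) hNx
  have hNb0 : 0 < normForm b := hNx0.trans hwin.2
  have hb'pos : 0 < ‖cplxEmb b‖ := by
    have h := norm_cplxEmb_sq hb; have : 0 < normForm b / ell b := div_pos hNb0 hb
    nlinarith [norm_nonneg (cplxEmb b)]
  -- the ratio of squares
  set r : ℝ := ‖cplxEmb x‖ / ‖cplxEmb b‖ with hr
  have hr0 : 0 ≤ r := by positivity
  have hrsq : r ^ 2 = (normForm x / normForm b) * (ell b / ell x) := by
    rw [hr, div_pow, norm_cplxEmb_sq hx, norm_cplxEmb_sq hb]; field_simp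
  -- `ell b / ell x = exp(-v σ) ∈ [1 - 2vΔ, 1 + 2vΔ]`
  have hsmall : |unitLog * unitCoord b x| ≤ 1 := by
    rw [abs_mul, abs_of_pos hv]; nlinarith [abs_nonneg (unitCoord b x)]
  have hratio : ell b / ell x = Real.exp (-(unitLog * unitCoord b x)) := by
    have : unitLog * unitCoord b x = Real.log (ell x) - Real.log (ell b) := by rw [unitCoord]; field_simp
    rw [this, neg_sub, Real.exp_sub, Real.exp_log hx, Real.exp_log hb]
  have hE : |Real.exp (-(unitLog * unitCoord b x)) - 1| ≤ 2 * unitLog * Δ := by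
    have h1 := Real.abs_exp_sub_one_le (x := -(unitLog * unitCoord b x)) (by rwa [abs_neg])
    rw [abs_neg, abs_mul, abs_of_pos hv] at h1
    calc |Real.exp (-(unitLog * unitCoord b x)) - 1| ≤ 2 * (unitLog * |unitCoord b x|) := h1
      _ ≤ 2 * (unitLog * Δ) := by gcongr
      _ = 2 * unitLog * Δ := by ring
  -- `normForm x / normForm b ∈ [1 - Δ/c₄, 1]`
  have hq1 : normForm x / normForm b ≤ 1 := (div_le_one hNb0).mpr hwin.2.le
  have hq2 : 1 - Δ / c₄ ≤ normForm x / normForm b := by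
    rw [le_div_iff₀ hNb0]
    have : Δ * V ≤ Δ / c₄ * normForm b := by
      rw [div_mul_eq_mul_div, le_div_iff₀ hc₄]
      have := hwin.2.le; nlinarith
    nlinarith [hwin.1]
  -- so `|r² - 1| ≤ Δ/c₄ + 4vΔ`
  have hδ : |r ^ 2 - 1| ≤ Δ / c₄ + 4 * unitLog * Δ := by
    rw [hrsq, hratio]
    set e := Real.exp (-(unitLog * unitCoord b x)) with he
    set a := normForm x / normForm b with ha
    have he1 : |e - 1| ≤ 2 * unitLog * Δ := hE
    have ha1 : |a - 1| ≤ Δ / c₄ := by rw [abs_sub_comm, abs_of_nonneg (by linarith)]; linarith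
    have hvΔ : 2 * unitLog * Δ ≤ 1 := by nlinarith
    calc |a * e - 1| = |(a - 1) * e + (e - 1)| := by ring_nf
      _ ≤ |a - 1| * |e| + |e - 1| := by rw [← abs_mul]; exact abs_add_le _ _
      _ ≤ Δ / c₄ * (1 + 2 * unitLog * Δ) + 2 * unitLog * Δ := by
          gcongr
          · calc |e| = |(e - 1) + 1| := by ring_nf
              _ ≤ |e - 1| + 1 := by simpa using abs_add_le (e - 1) 1
              _ ≤ 2 * unitLog * Δ + 1 := by linarith
              _ = 1 + 2 * unitLog * Δ := by ring
      _ ≤ Δ / c₄ + 4 * unitLog * Δ := by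
          have : Δ / c₄ ≤ 1 := (div_le_one hc₄).mpr hΔc
          nlinarith [mul_nonneg (sub_nonneg.mpr this) (by positivity : (0 : ℝ) ≤ 2 * unitLog * Δ)]
  have hr1 : |r - 1| ≤ Δ / c₄ + 4 * unitLog * Δ := (abs_sub_one_le_abs_sq_sub_one hr0).trans hδ
  have : ‖cplxEmb x‖ - ‖cplxEmb b‖ = (r - 1) * ‖cplxEmb b‖ := by rw [hr]; field_simp
  rw [this, abs_mul, abs_of_pos hb'pos]
  exact mul_le_mul_of_nonneg_right hr1 hb'pos.le

/-- **`β'(𝐱) = (1 + O(Δ))β'(b)`** (the comparison of (9.13) and (9.14)): under the hypotheses of Lemma 9.5,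
`‖β'(𝐱) − β'(b)‖ ≤ (12π + 8 + 1/c₄) Δ ‖β'(b)‖`. [cite: HeathBrownActa2001, §9 (9.11)] -/
theorem norm_cplxEmb_sub_le {c₄ V : ℝ} (hc₄ : 0 < c₄) (hV : 0 < V) (hΔ : 0 < Δ) (hΔ16 : Δ ≤ 1 / 16)
    (hΔc : Δ ≤ c₄ / 2) (hb : 0 < ell b) (hx : 0 < ell x) (hnear : Near b x) (hW : pairWeight Δ b x ≠ 0)
    (hwin : normForm b - Δ * V ≤ normForm x ∧ normForm x < normForm b) (hNx : c₄ * V ≤ normForm x) :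
    ‖cplxEmb x - cplxEmb b‖ ≤ (12 * Real.pi + 8 + 1 / c₄) * Δ * ‖cplxEmb b‖ := by
  have hv := unitLog_pos
  have hv2 := unitLog_le_two
  have hΔ4 : Δ ≤ 1 / 4 := by linarith
  have hNx0 : 0 < normForm x := lt_of_lt_of_le (by positivity) hNx
  have hNb0 : 0 < normForm b := hNx0.trans hwin.2
  have hx' : cplxEmb x ≠ 0 := cplxEmb_ne_zero_of_normForm_ne_zero hNx0.ne'
  have hb' : cplxEmb b ≠ 0 := cplxEmb_ne_zero_of_normForm_ne_zero hNb0.ne'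
  have hσ := abs_unitCoord_lt hΔ hΔ4 hb hx hnear hW
  have hmod := abs_norm_cplxEmb_sub_le hc₄ hV hΔ hΔ4 (by linarith) hb hx hσ hwin hNx
  obtain ⟨η, hη, hdir⟩ := exists_angle_of_pairWeight_ne_zero hΔ hΔ4 hb hb' hx hx' hnear hW
  set δ₂ : ℝ := Δ / c₄ + 4 * unitLog * Δ with hδ₂
  have hδ₂1 : δ₂ ≤ 1 := by
    have : Δ / c₄ ≤ 1 / 2 := by rw [div_le_iff₀ hc₄]; linarith
    rw [hδ₂]; nlinarith
  -- polar decompositions `x' = ‖x'‖ d_x`, `b' = ‖b'‖ d_b`, `d_x = d_b e^{iη}`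
  set dB := Complex.exp (Complex.arg (cplxEmb b) * Complex.I) with hdB
  have hxpol : cplxEmb x = (‖cplxEmb x‖ : ℂ) * (dB * Complex.exp (η * Complex.I)) := by
    rw [← hdir]; exact (Complex.norm_mul_exp_arg_mul_I _).symm
  have hbpol : cplxEmb b = (‖cplxEmb b‖ : ℂ) * dB := (Complex.norm_mul_exp_arg_mul_I _).symm
  have hdB1 : ‖dB‖ = 1 := by rw [hdB, Complex.norm_exp_ofReal_mul_I]
  have hηI : ‖(η : ℂ) * Complex.I‖ ≤ 1 := by
    rw [norm_mul, Complex.norm_I, mul_one, Complex.norm_real, Real.norm_eq_abs]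
    have := Real.pi_le_four
    nlinarith
  have hexp1 : ‖Complex.exp (η * Complex.I) - 1‖ ≤ 2 * (3 * Real.pi * Δ) := by
    calc ‖Complex.exp (η * Complex.I) - 1‖ ≤ 2 * ‖(η : ℂ) * Complex.I‖ := Complex.norm_exp_sub_one_le hηI
      _ = 2 * |η| := by rw [norm_mul, Complex.norm_I, mul_one, Complex.norm_real, Real.norm_eq_abs]
      _ ≤ 2 * (3 * Real.pi * Δ) := by gcongr
  -- `x' - b' = dB (‖x'‖ (e^{iη} - 1) + (‖x'‖ - ‖b'‖))`
  have hdiff : cplxEmb x - cplxEmb b =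
      dB * ((‖cplxEmb x‖ : ℂ) * (Complex.exp (η * Complex.I) - 1) + ((‖cplxEmb x‖ - ‖cplxEmb b‖ : ℝ) : ℂ)) := by
    conv_lhs => rw [hxpol]; rw [hbpol]
    push_cast; ring
  have hxle : ‖cplxEmb x‖ ≤ 2 * ‖cplxEmb b‖ := by
    have := abs_le.mp hmod; nlinarith [norm_nonneg (cplxEmb b)]
  calc ‖cplxEmb x - cplxEmb b‖
      = ‖(‖cplxEmb x‖ : ℂ) * (Complex.exp (η * Complex.I) - 1) + ((‖cplxEmb x‖ - ‖cplxEmb b‖ : ℝ) : ℂ)‖ := by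
        rw [hdiff, norm_mul, hdB1, one_mul]
    _ ≤ ‖cplxEmb x‖ * ‖Complex.exp (η * Complex.I) - 1‖ + |‖cplxEmb x‖ - ‖cplxEmb b‖| := by
        refine (norm_add_le _ _).trans ?_
        rw [norm_mul, Complex.norm_real, Real.norm_eq_abs, abs_of_nonneg (norm_nonneg _), Complex.norm_real,
          Real.norm_eq_abs]
    _ ≤ 2 * ‖cplxEmb b‖ * (2 * (3 * Real.pi * Δ)) + δ₂ * ‖cplxEmb b‖ := by
        gcongr
    _ = (12 * Real.pi + 4 * unitLog + 1 / c₄) * Δ * ‖cplxEmb b‖ := by rw [hδ₂]; ring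
    _ ≤ (12 * Real.pi + 8 + 1 / c₄) * Δ * ‖cplxEmb b‖ := by
        have : 0 ≤ Δ * ‖cplxEmb b‖ := by positivity
        nlinarith

/-! ### The Minkowski embedding and its inverse are bounded -/

/-- **Forward bound** `‖(β(p), β'(p))‖ ≤ 6‖p‖` (sup norms; `ρ < 13/10`). [folklore] -/
theorem norm_embW_le (p : ℝ × ℝ × ℝ) : ‖embW p‖ ≤ 6 * ‖p‖ := by
  have hρ := rho_pos; have hρ' := rho_lt
  have h1 : |p.1| ≤ ‖p‖ := by rw [Prod.norm_def]; exact le_max_left _ _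
  have h2 : |p.2.1| ≤ ‖p‖ := by
    rw [Prod.norm_def, Prod.norm_def]; exact (le_max_left _ _).trans (le_max_right _ _)
  have h3 : |p.2.2| ≤ ‖p‖ := by
    rw [Prod.norm_def, Prod.norm_def]; exact (le_max_right _ _).trans (le_max_right _ _)
  have hp0 : 0 ≤ ‖p‖ := norm_nonneg _
  have hs : Real.sqrt 3 ≤ 2 := by
    rw [show (2 : ℝ) = Real.sqrt (2 ^ 2) by rw [Real.sqrt_sq (by norm_num)]]
    exact Real.sqrt_le_sqrt (by norm_num)
  have hs0 : 0 ≤ Real.sqrt 3 := Real.sqrt_nonneg _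
  have hρ2 : 0 < rho ^ 2 := pow_pos hρ 2
  have hk : rho + rho ^ 2 ≤ 3 := by nlinarith
  have hA : |rho * p.2.1| + |rho ^ 2 * p.2.2| ≤ 3 * ‖p‖ := by
    rw [abs_mul, abs_mul, abs_of_pos hρ, abs_of_pos hρ2]
    calc rho * |p.2.1| + rho ^ 2 * |p.2.2| ≤ rho * ‖p‖ + rho ^ 2 * ‖p‖ := by gcongr
      _ = (rho + rho ^ 2) * ‖p‖ := by ring
      _ ≤ 3 * ‖p‖ := by gcongr
  rw [embW_apply, Prod.norm_def]
  refine max_le ?_ ?_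
  · rw [Real.norm_eq_abs, ell]
    calc |p.1 + rho * p.2.1 + rho ^ 2 * p.2.2| ≤ |p.1| + |rho * p.2.1| + |rho ^ 2 * p.2.2| := abs_add_three _ _ _
      _ ≤ ‖p‖ + 3 * ‖p‖ := by linarith
      _ ≤ 6 * ‖p‖ := by linarith
  · refine (Complex.norm_le_abs_re_add_abs_im _).trans ?_
    rw [cplxEmb_re, cplxEmb_im]
    have h4 : |p.1 - (rho * p.2.1 + rho ^ 2 * p.2.2) / 2| ≤ ‖p‖ + 3 * ‖p‖ / 2 := by
      calc |p.1 - (rho * p.2.1 + rho ^ 2 * p.2.2) / 2| ≤ |p.1| + |(rho * p.2.1 + rho ^ 2 * p.2.2) / 2| := abs_sub _ _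
        _ ≤ ‖p‖ + 3 * ‖p‖ / 2 := by
            rw [abs_div, abs_two]
            have := abs_add_le (rho * p.2.1) (rho ^ 2 * p.2.2)
            gcongr ?_ + ?_
            linarith
    have h5 : |Real.sqrt 3 / 2 * (rho * p.2.1 - rho ^ 2 * p.2.2)| ≤ 3 * ‖p‖ := by
      rw [abs_mul, abs_of_nonneg (by positivity)]
      have := abs_sub (rho * p.2.1) (rho ^ 2 * p.2.2)
      calc Real.sqrt 3 / 2 * |rho * p.2.1 - rho ^ 2 * p.2.2| ≤ 2 / 2 * (3 * ‖p‖) := by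
            gcongr; linarith
        _ = 3 * ‖p‖ := by ring
    linarith

/-- `dim_ℝ ℝ³ = dim_ℝ (ℝ × ℂ) = 3`. [folklore] -/
theorem finrank_coeff_eq_finrank_W : Module.finrank ℝ (ℝ × ℝ × ℝ) = Module.finrank ℝ (ℝ × ℂ) := by
  simp [Module.finrank_prod, Complex.finrank_real_complex]

/-- **Inverse bound**: there is `C > 0` with `‖p‖ ≤ C ‖(β(p), β'(p))‖` for all `p ∈ ℝ³` (the Minkowski
embedding is a linear isomorphism of `3`-dimensional spaces). [folklore] -/
theorem exists_norm_le_norm_embW : ∃ C : ℝ, 0 < C ∧ ∀ p : ℝ × ℝ × ℝ, ‖p‖ ≤ C * ‖embW p‖ := by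
  let e : (ℝ × ℝ × ℝ) ≃ₗ[ℝ] (ℝ × ℂ) := LinearMap.linearEquivOfInjective embW embW_injective finrank_coeff_eq_finrank_W
  let ec : (ℝ × ℝ × ℝ) ≃L[ℝ] (ℝ × ℂ) := e.toContinuousLinearEquiv
  refine ⟨max ‖(ec.symm : (ℝ × ℂ) →L[ℝ] (ℝ × ℝ × ℝ))‖ 1, lt_max_of_lt_right one_pos, fun p => ?_⟩
  have he : ec p = embW p := by
    show e p = embW p
    exact LinearMap.linearEquivOfInjective_apply _ _ p
  calc ‖p‖ = ‖ec.symm (ec p)‖ := by rw [ContinuousLinearEquiv.symm_apply_apply]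
    _ ≤ ‖(ec.symm : (ℝ × ℂ) →L[ℝ] (ℝ × ℝ × ℝ))‖ * ‖ec p‖ := (ec.symm : (ℝ × ℂ) →L[ℝ] (ℝ × ℝ × ℝ)).le_opNorm _
    _ ≤ max ‖(ec.symm : (ℝ × ℂ) →L[ℝ] (ℝ × ℝ × ℝ))‖ 1 * ‖embW p‖ := by
        rw [he]; gcongr; exact le_max_left _ _

/-! ### Lemma 9.5 -/

/-- **Heath-Brown's Lemma 9.5, quantitative** ("Let `V ≪ N(S)`, `N(𝐱) ≪ V`, and suppose that
`W(S; Δ, 𝐱) ≠ 0` and that `N(𝐱) < N(S) ≤ N(𝐱) + ΔV`. Then `S` has a generator `β` for which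
`β̂ = (1 + O(Δ))𝐱`", p. 56; "If `𝐱 ∈ 𝒞` then Lemma 9.5 shows that `β̂ = 𝐱 + O(V^{1/3}Δ)`", p. 57).
Our form: there is an absolute `C₀ > 0` such that for `0 < Δ ≤ min(1/16, c₄/2)`, vectors `b, 𝐱` with
`β(b), β(𝐱) > 0` on the same branch (`Near b 𝐱`: the generator is already the right associate) with
`W(b; Δ, 𝐱) ≠ 0`, `N(b) − ΔV ≤ N(𝐱) < N(b)` and `N(𝐱) ≥ c₄V > 0`, one has
`‖𝐱 − b‖_∞ ≤ C₀ (1 + c₄⁻¹) Δ ‖b‖_∞`. Proof as printed (pp. 57): `|σ| < Δ` gives (9.12)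
`β(𝐱) = (1+O(Δ))β(b)` (`abs_ell_sub_ell_le`); the window gives `|β'(𝐱)|² = N(𝐱)/β(𝐱) = (1+O(Δ))|β'(b)|²`
(9.14) (`abs_norm_cplxEmb_sub_le`); the `ν₁`-window gives `arg β'(𝐱) = arg β'(b) + O(Δ)` (9.13); hence
`β'(𝐱) = (1+O(Δ))β'(b)` (`norm_cplxEmb_sub_le`) and one inverts the Minkowski embedding
(`exists_norm_le_norm_embW`). [cite: HeathBrownActa2001, Lemma 9.5] -/
theorem HeathBrown2001_lemma_9_5 : ∃ C₀ : ℝ, 0 < C₀ ∧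
    ∀ (c₄ V Δ : ℝ) (b x : ℝ × ℝ × ℝ), 0 < c₄ → 0 < V → 0 < Δ → Δ ≤ 1 / 16 → Δ ≤ c₄ / 2 →
      0 < ell b → 0 < ell x → Near b x → pairWeight Δ b x ≠ 0 →
      normForm b - Δ * V ≤ normForm x ∧ normForm x < normForm b → c₄ * V ≤ normForm x →
        ‖x - b‖ ≤ C₀ * (1 + 1 / c₄) * Δ * ‖b‖ := by
  obtain ⟨C, hC, hinv⟩ := exists_norm_le_norm_embW
  refine ⟨6 * C * (12 * Real.pi + 9), by positivity, ?_⟩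
  intro c₄ V Δ b x hc₄ hV hΔ hΔ16 hΔc hb hx hnear hW hwin hNx
  have hv2 := unitLog_le_two
  have hΔ4 : Δ ≤ 1 / 4 := by linarith
  have hσ := abs_unitCoord_lt hΔ hΔ4 hb hx hnear hW
  have h1 := abs_ell_sub_ell_le hΔ4 hb hx hσ
  have h2 := norm_cplxEmb_sub_le hc₄ hV hΔ hΔ16 hΔc hb hx hnear hW hwin hNx
  -- `‖embW (x - b)‖ ≤ (12π + 8 + 1/c₄) Δ ‖embW b‖`
  have hEb : ell b ≤ ‖embW b‖ ∧ ‖cplxEmb b‖ ≤ ‖embW b‖ := by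
    rw [embW_apply, Prod.norm_def, Real.norm_eq_abs, abs_of_pos hb]; exact ⟨le_max_left _ _, le_max_right _ _⟩
  have hE : ‖embW (x - b)‖ ≤ (12 * Real.pi + 8 + 1 / c₄) * Δ * ‖embW b‖ := by
    rw [map_sub, embW_apply, embW_apply, Prod.mk_sub_mk, Prod.norm_def, Real.norm_eq_abs]
    refine max_le ?_ ?_
    · calc |ell x - ell b| ≤ 2 * unitLog * Δ * ell b := h1
        _ ≤ (12 * Real.pi + 8 + 1 / c₄) * Δ * ‖embW b‖ := by
            have : 2 * unitLog ≤ 12 * Real.pi + 8 + 1 / c₄ := by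
              have := Real.pi_pos; have := div_nonneg one_pos.le hc₄.le; nlinarith
            have h0 : 0 ≤ Δ * ell b := by positivity
            calc 2 * unitLog * Δ * ell b = (2 * unitLog) * (Δ * ell b) := by ring
              _ ≤ (12 * Real.pi + 8 + 1 / c₄) * (Δ * ‖embW b‖) := by gcongr; exact hEb.1
              _ = _ := by ring
    · calc ‖cplxEmb x - cplxEmb b‖ ≤ (12 * Real.pi + 8 + 1 / c₄) * Δ * ‖cplxEmb b‖ := h2
        _ ≤ (12 * Real.pi + 8 + 1 / c₄) * Δ * ‖embW b‖ := by
            have : 0 ≤ (12 * Real.pi + 8 + 1 / c₄) * Δ := by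
              have := Real.pi_pos; have := div_nonneg one_pos.le hc₄.le; positivity
            exact mul_le_mul_of_nonneg_left hEb.2 this
  calc ‖x - b‖ ≤ C * ‖embW (x - b)‖ := hinv _
    _ ≤ C * ((12 * Real.pi + 8 + 1 / c₄) * Δ * ‖embW b‖) := by gcongr
    _ ≤ C * ((12 * Real.pi + 8 + 1 / c₄) * Δ * (6 * ‖b‖)) := by
        have : 0 ≤ (12 * Real.pi + 8 + 1 / c₄) * Δ := by
          have := Real.pi_pos; have := div_nonneg one_pos.le hc₄.le; positivity
        gcongr; exact norm_embW_le b
    _ = 6 * C * (12 * Real.pi + 8 + 1 / c₄) * Δ * ‖b‖ := by ring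
    _ ≤ 6 * C * (12 * Real.pi + 9) * (1 + 1 / c₄) * Δ * ‖b‖ := by
        have h0 : 0 ≤ Δ * ‖b‖ := by positivity
        have hc : 0 ≤ 1 / c₄ := div_nonneg one_pos.le hc₄.le
        have hπ := Real.pi_pos
        have : (12 * Real.pi + 8 + 1 / c₄) ≤ (12 * Real.pi + 9) * (1 + 1 / c₄) := by nlinarith
        calc 6 * C * (12 * Real.pi + 8 + 1 / c₄) * Δ * ‖b‖ = 6 * C * ((12 * Real.pi + 8 + 1 / c₄) * (Δ * ‖b‖)) := by ring
          _ ≤ 6 * C * ((12 * Real.pi + 9) * (1 + 1 / c₄) * (Δ * ‖b‖)) := by gcongr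
          _ = _ := by ring

/-- **Lemma 9.5 read from `𝐱`**: if `‖𝐱 − b‖ ≤ κ‖b‖` with `0 ≤ κ ≤ 1/2` then `‖b‖ ≤ 2‖𝐱‖` and
`‖𝐱 − b‖ ≤ 2κ‖𝐱‖` ("Similarly, if `β` is any generator of `S`, then `𝐱` has an associate `𝐱'` for which
`β̂ = (1 + O(Δ))𝐱'`", p. 56). [cite: HeathBrownActa2001, Lemma 9.5] -/
theorem norm_le_two_mul_of_norm_sub_le {κ : ℝ} {b x : ℝ × ℝ × ℝ} (h : ‖x - b‖ ≤ κ * ‖b‖) (hκ : 0 ≤ κ)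
    (hκ2 : κ ≤ 1 / 2) : ‖b‖ ≤ 2 * ‖x‖ ∧ ‖x - b‖ ≤ 2 * κ * ‖x‖ := by
  have hb : ‖b‖ ≤ ‖x‖ + ‖x - b‖ := by
    calc ‖b‖ = ‖x - (x - b)‖ := by rw [sub_sub_cancel]
      _ ≤ ‖x‖ + ‖x - b‖ := norm_sub_le _ _
  have h1 : ‖b‖ ≤ 2 * ‖x‖ := by nlinarith [norm_nonneg b, norm_nonneg x]
  exact ⟨h1, h.trans (by nlinarith)⟩

/-! ### Exactly one positive generator of `S` on the branch of `𝐱` -/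

/-- `σ` for products: `σ((βγ)^, 𝐱) = σ(β̂, 𝐱) − log(ellO γ)/v` (`β, γ > 0`). [folklore] -/
theorem unitCoord_realVec_mul {β γ : 𝓞 K} (hβ : 0 < ellO β) (hγ : 0 < ellO γ) (x : ℝ × ℝ × ℝ) :
    unitCoord (realVec (β * γ)) x = unitCoord (realVec β) x - Real.log (ellO γ) / unitLog := by
  rw [unitCoord, unitCoord, ell_realVec, ell_realVec, ellO_mul, Real.log_mul hβ.ne' hγ.ne']
  field_simp
  ring

/-- `ellO (u_E^n) = E^n`. [folklore] -/
theorem ellO_unitGen_zpow (n : ℤ) : ellO ((unitGen ^ n : (𝓞 K)ˣ) : 𝓞 K) = unitE ^ n := by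
  rw [ellO_units_zpow, ellO_unitGen]

/-- **Multiplying the generator by `u_E^n` shifts the unit coordinate by `−n`.** [folklore] -/
theorem unitCoord_realVec_mul_unitGen_zpow {β : 𝓞 K} (hβ : 0 < ellO β) (n : ℤ) (x : ℝ × ℝ × ℝ) :
    unitCoord (realVec (β * ((unitGen ^ n : (𝓞 K)ˣ) : 𝓞 K))) x = unitCoord (realVec β) x - n := by
  rw [unitCoord_realVec_mul hβ (by rw [ellO_unitGen_zpow]; exact zpow_pos unitE_pos n), ellO_unitGen_zpow,
    Real.log_zpow, unitLog, mul_div_assoc, div_self (Real.log_pos one_lt_unitE).ne', mul_one]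

/-- **The positive generators of `(β₀)` are the `β₀ u_E^n`** (a generator is `±u_E^n β₀`, and the sign is
fixed by positivity in the real embedding). [folklore] -/
theorem exists_eq_mul_unitGen_zpow {β₀ β : 𝓞 K} (hβ₀ : 0 < ellO β₀) (hβ : 0 < ellO β)
    (h : Ideal.span {β} = Ideal.span {β₀}) : ∃ n : ℤ, β = β₀ * ((unitGen ^ n : (𝓞 K)ˣ) : 𝓞 K) := by
  obtain ⟨u, hu⟩ := Ideal.span_singleton_eq_span_singleton.mp h.symm
  obtain ⟨n, hn | hn⟩ := exists_units_eq_unitGen_zpow u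
  · exact ⟨n, by rw [← hu, hn]⟩
  · exfalso
    have h1 : ellO β = -(ellO β₀ * unitE ^ n) := by
      rw [← hu, hn, ellO_mul, Units.val_neg, ellO_neg, ellO_unitGen_zpow]; ring
    have : 0 < ellO β₀ * unitE ^ n := mul_pos hβ₀ (zpow_pos unitE_pos n)
    linarith

/-- Every non-zero ideal has a generator positive in the real embedding. [folklore] -/
theorem exists_pos_generator {S : Ideal (𝓞 K)} (hS : S ≠ ⊥) : ∃ β₀ : 𝓞 K, Ideal.span {β₀} = S ∧ 0 < ellO β₀ := by
  have hg := idealGen_ne_zero hS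
  rcases lt_or_gt_of_ne (ellO_ne_zero hg) with h | h
  · refine ⟨-idealGen S, ?_, by rw [ellO_neg]; linarith⟩
    rw [Ideal.span_singleton_neg, span_idealGen]
  · exact ⟨idealGen S, span_idealGen S, h⟩

/-- **Exactly one positive generator of `S ≠ 0` lies on the branch of `𝐱`** (`β(𝐱) > 0`): the positive
generators are `β₀u_E^n`, with unit coordinates `σ₀ − n`, and exactly one `n` puts this in `[−1/2, 1/2)`.
This replaces "The set `𝓕` has the property that each non-zero `𝐱` has a unique associate in `𝓕`" (p. 59).
[cite: HeathBrownActa2001, §9 p. 59] -/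
theorem existsUnique_near_generator {S : Ideal (𝓞 K)} (hS : S ≠ ⊥) (x : ℝ × ℝ × ℝ) :
    ∃! β : 𝓞 K, Ideal.span {β} = S ∧ 0 < ellO β ∧ Near (realVec β) x := by
  obtain ⟨β₀, hβ₀S, hβ₀⟩ := exists_pos_generator hS
  set σ₀ : ℝ := unitCoord (realVec β₀) x with hσ₀
  set n : ℤ := ⌊σ₀ + 1 / 2⌋ with hn
  have hfl := Int.floor_le (σ₀ + 1 / 2)
  have hlt := Int.lt_floor_add_one (σ₀ + 1 / 2)
  refine ⟨β₀ * ((unitGen ^ n : (𝓞 K)ˣ) : 𝓞 K), ⟨?_, ?_, ?_⟩, ?_⟩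
  · rw [Ideal.span_singleton_mul_right_unit (Units.isUnit _), hβ₀S]
  · rw [ellO_mul, ellO_unitGen_zpow]; exact mul_pos hβ₀ (zpow_pos unitE_pos n)
  · rw [Near, unitCoord_realVec_mul_unitGen_zpow hβ₀, Set.mem_Ico, ← hσ₀]
    rw [← hn] at hfl hlt
    constructor <;> linarith
  · rintro β ⟨hβS, hβpos, hβnear⟩
    obtain ⟨m, rfl⟩ := exists_eq_mul_unitGen_zpow hβ₀ hβpos (by rw [hβS, hβ₀S])
    rw [Near, unitCoord_realVec_mul_unitGen_zpow hβ₀, Set.mem_Ico, ← hσ₀] at hβnear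
    have hm : m = n := by
      rw [hn, eq_comm, Int.floor_eq_iff]
      constructor <;> linarith [hβnear.1, hβnear.2]
    rw [hm]

/-- The weight `W` is the same for all positive generators of `S` on the `b`-side: multiplying `b` by
`ε̂` does not change `ν₁(b)`, `ν₂(b)`. [cite: HeathBrownActa2001, §9 p. 53] -/
theorem pairWeight_realVec_mul_units {β : 𝓞 K} (hβ : β ≠ 0) (u : (𝓞 K)ˣ) (x : ℝ × ℝ × ℝ) :
    pairWeight Δ (realVec (β * u)) x = pairWeight Δ (realVec β) x := by
  rw [pairWeight, pairWeight, show nu1 (realVec (β * u)) = nu1O (β * u) from rfl, show nu2 (realVec (β * u)) = nu2O (β * u) from rfl,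
    nu1O_mul hβ (Units.ne_zero u), nu2O_mul hβ (Units.ne_zero u), nu1O_units, nu2O_units, mul_one, mul_one]
  rfl

end Literature.NumberTheory.Sieve.CubicSieve
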